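import Mathlib
import HarnessLib
import Summits.QuantumFields.YangMills.Theorems.ComplexCouplingChannelContinuumLegGivenGapArraysReduction
import Summits.QuantumFields.YangMills.Theorems.ComplexCouplingChannelContinuumLegGivenGapStubPtuGeometry
import Summits.QuantumFields.YangMills.Theorems.ComplexCouplingChannelContinuumLegGivenGapStubPtuDerivatives
import Summits.QuantumFields.YangMills.Theorems.ComplexCouplingChannelContinuumLegGivenGapStubPtuAnalysis
import Summits.QuantumFields.YangMills.Theorems.ComplexCouplingChannelContinuumLegGivenGapStubPtuAssembly

/-!
# Line `alternating-curvature-arrays`: (PB) ⇒ (UUVB) is a THEOREM; the crux `ContinuumLegGivenGap` (stmt-QuantumFields-15828)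
reduced to the bet (CB) and the two sockets

`arrays_productToUniform : PolyVolumeGrowth sch → ProductBound r sch → UUVB r sch` (registered sub-goal; the former stub
`stub_productToUniform` — the Whitney / grid-shift / nuclear step) from the four landed pieces `stub_ptuAssembly stub_ptuGeometry
stub_ptuDerivatives stub_ptuAnalysis`, and the line's reduction with that hypothesis DISCHARGED:
`ContinuumLegGivenGap_of_arrayExponent : XiDiverges → ⟨FR⟩ → ⟨CB⟩ → ⟨SW⟩ → ComplexCouplingChannel.ContinuumLegGivenGap` (+ six by-name
twins), where (FR) = `stub_floorAndRotation` (child 2 minus (UUVB), tail-shaped; open), (CB) = `stub_arrayExponent` (ONE k-uniform bound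
on the one-body array exponent per scale — the line's bet; open, UV content) and (SW) = `stub_skewWindow` (child 3; open) are taken
VERBATIM as def-free hypotheses.  Every reflection-positivity / chessboard / Whitney / lattice-kinematic step between them and the crux
is now proved in the tree.  No definitions. [folklore]
-/

set_option autoImplicit false

noncomputable section

namespace Summit.QuantumFields.YangMills.Theorems.ContinuumLegGivenGap

open scoped SchwartzMap
open Filter Topology MeasureTheory
open Literature.MathematicalPhysics.QuantumFieldTheory Literature.MathematicalPhysics.QuantumLattice
  Literature.MathematicalPhysics.AQFT Literature.Probability.LatticeModels
open Summit.QuantumFields.YangMills.Theses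
open Summit.QuantumFields.YangMills.Cruxes.ContinuumLimitOnTrajectory.TwoOrbitSynchronisation
  (PlaqIdx plaq canonDistribution UUVB PolyVolumeGrowth)
open Summit.QuantumFields.YangMills.Theorems.ContinuumLegGivenGap.AlternatingArrays

/-- **(PB) ⇒ (UUVB)** — the Whitney / grid-shift / nuclear step of the line (former stub `stub_productToUniform`, registered
signature verbatim): polynomial volume growth and the chessboard product bound on real core-supported tensors give the k-uniform
E0′ bounds for all plaquette strings.  PROVED: the landed assembly `stub_ptuAssembly` fed with the landed pieces
`stub_ptuGeometry`, `stub_ptuDerivatives`, `stub_ptuAnalysis`. [folklore] -/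
theorem arrays_productToUniform :
    ∀ (G : Type) [Group G] [TopologicalSpace G] [IsTopologicalGroup G] [CompactSpace G]
          [MeasurableSpace G] [BorelSpace G] (r : LatticeRep G) (sch : SpeciesScheme (YMSpecies G)),
          PolyVolumeGrowth sch → ProductBound r sch → UUVB r sch :=
  stub_ptuAssembly stub_ptuGeometry stub_ptuDerivatives stub_ptuAnalysis


end Summit.QuantumFields.YangMills.Theorems.ContinuumLegGivenGap

end
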